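import Summits.QuantumFields.YangMills.Theorems.F4SubCurvatureDoorHexagonPolynomial
import Mathlib
import HarnessLib

/-!
# Hexagon normal form — no POLYNOMIAL pair passes the hexagon Wick test, case `deg F = deg G + 3`, `lc F + lc G ≠ 0`

Support lemma toward the OPEN finite-type hexagon conjecture behind crux `stmt-QuantumFields-23125`
(`F4SubCurvatureDoor.RationalToGeneral`), continuing `F4SubCurvatureDoorHexagonPolynomial.lean` (rescaling principle).

* `hexagonPencil_cubic_limit` — CASE `deg F = deg G + 3` with `a·lc(G) = lc(F) + lc(G)`, `a ≠ 0`: rescaling `z = s w` the pencil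
  `Φ_s = F + P_s G` tends to `lc(G) w^g (a w³ − 18 w² + 48 w − 32)`, so (rescaling principle) every complex root of that polynomial
  lies in `{Im w = 0, Re w ≤ 1}` — the input of the HEXAGON CUBIC LEMMA (owner's HOME l15/HexagonCubic.lean, ported to the tree by
  seat sfw-p2-w4), which says this never happens.

Mathlib + tree helpers only; THEOREMS ONLY; no `sorry`; default heartbeats.  Nothing about crux 23125, crux 23035, any LADDER-YM
rung or the Yang–Mills mass gap is proved here.  Free-hands seat `ym-line-frs-p2` g10, `--supports stmt-QuantumFields-23125`.
-/

set_option autoImplicit false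

open Filter Topology Polynomial

namespace Summit.QuantumFields.YangMills.Cruxes.RationalToGeneral.HexagonNormalForm

/-- **Case `deg F = deg G + 3`, non-degenerate: the rescaled limit is the hexagon cubic.**  If `lc F + lc G ≠ 0` and
`WickHexagon F G` holds for the real polynomial pair, then every complex root of `lc(G) X^g (a X³ − 18 X² + 48 X − 32)`,
`a = (lc F + lc G)/lc G`, is real and `≤ 1`. [folklore] -/
theorem hexagonPencil_cubic_limit (F G : ℝ[X]) (hG : G ≠ 0) (hfg : F.natDegree = G.natDegree + 3)
    (hlc : F.leadingCoeff + G.leadingCoeff ≠ 0)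
    (hW : WickHexagon (fun z => Polynomial.aeval z F) (fun z => Polynomial.aeval z G)) :
    ∀ w : ℂ, Polynomial.aeval w (Polynomial.C G.leadingCoeff * X ^ G.natDegree *
      (Polynomial.C ((F.leadingCoeff + G.leadingCoeff) / G.leadingCoeff) * X ^ 3 - Polynomial.C 18 * X ^ 2 +
        Polynomial.C 48 * X - Polynomial.C 32)) = 0 → w ∈ {w : ℂ | w.im = 0 ∧ w.re ≤ 1} := by
  classical
  set g := G.natDegree with hg
  have hlcG : G.leadingCoeff ≠ 0 := leadingCoeff_ne_zero.2 hG
  have hXk : ∀ (k i : ℕ), (X ^ k * G).coeff i = if k ≤ i then G.coeff (i - k) else 0 := fun k i => by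
    rw [coeff_X_pow_mul']
  have hX1 : ∀ i : ℕ, (X * G).coeff i = if 1 ≤ i then G.coeff (i - 1) else 0 := fun i => by
    rw [← pow_one (X : ℝ[X]), hXk 1]
  have hGz : ∀ j, g < j → G.coeff j = 0 := fun j hj => coeff_eq_zero_of_natDegree_lt hj
  have hlcg : G.coeff g = G.leadingCoeff := rfl
  have hlcf : F.coeff (g + 3) = F.leadingCoeff := by rw [← hfg]; rfl
  -- the pencil along `s = n + 1`
  set Φ : ℕ → ℝ[X] := fun n => F + (X ^ 3 - Polynomial.C (18 * ((n : ℝ) + 1)) * X ^ 2 +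
    Polynomial.C (48 * ((n : ℝ) + 1) ^ 2) * X - Polynomial.C (32 * ((n : ℝ) + 1) ^ 3)) * G with hΦ
  have hΦcoeff : ∀ n i, (Φ n).coeff i = F.coeff i + (X ^ 3 * G).coeff i - 18 * ((n : ℝ) + 1) * (X ^ 2 * G).coeff i +
      48 * ((n : ℝ) + 1) ^ 2 * (X * G).coeff i - 32 * ((n : ℝ) + 1) ^ 3 * G.coeff i := by
    intro n i; rw [hΦ]; simp only []; rw [coeff_pencil]
  have hΦtop : ∀ n, (Φ n).coeff (g + 3) = F.leadingCoeff + G.leadingCoeff := by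
    intro n
    rw [hΦcoeff, hlcf, hXk 3, if_pos (by omega), show g + 3 - 3 = g by omega, hlcg, hXk 2, if_pos (by omega),
      show g + 3 - 2 = g + 1 by omega, hGz (g + 1) (by omega), hX1, if_pos (by omega), show g + 3 - 1 = g + 2 by omega,
      hGz (g + 2) (by omega), hGz (g + 3) (by omega)]
    ring
  have hdeg : ∀ n, (Φ n).natDegree = g + 3 := by
    intro n
    refine natDegree_eq_of_le_of_coeff_ne_zero ?_ (by rw [hΦtop]; exact hlc)
    rw [hΦ]; simp only []
    refine (natDegree_add_le _ _).trans (max_le (by omega) ?_)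
    rw [natDegree_pencilMul G hG]
  -- the limit polynomial, expanded and factored
  set a : ℝ := (F.leadingCoeff + G.leadingCoeff) / G.leadingCoeff with ha
  have haG : G.leadingCoeff * a = F.leadingCoeff + G.leadingCoeff := by rw [ha]; field_simp
  set q : ℝ[X] := Polynomial.C G.leadingCoeff * X ^ g *
    (Polynomial.C a * X ^ 3 - Polynomial.C 18 * X ^ 2 + Polynomial.C 48 * X - Polynomial.C 32) with hq
  have hq' : q = Polynomial.C (F.leadingCoeff + G.leadingCoeff) * X ^ (g + 3) - Polynomial.C (18 * G.leadingCoeff) * X ^ (g + 2) +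
      Polynomial.C (48 * G.leadingCoeff) * X ^ (g + 1) - Polynomial.C (32 * G.leadingCoeff) * X ^ g := by
    rw [hq, ← haG]; simp only [map_mul]; ring
  have hqcoeff : ∀ i, q.coeff i = (if i = g + 3 then F.leadingCoeff + G.leadingCoeff else 0) -
      (if i = g + 2 then 18 * G.leadingCoeff else 0) + (if i = g + 1 then 48 * G.leadingCoeff else 0) -
      (if i = g then 32 * G.leadingCoeff else 0) := by
    intro i
    rw [hq', coeff_sub, coeff_add, coeff_sub, coeff_C_mul_X_pow, coeff_C_mul_X_pow, coeff_C_mul_X_pow, coeff_C_mul_X_pow]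
  have hqdeg : q.natDegree = g + 3 := by
    refine le_antisymm ?_ (le_natDegree_of_ne_zero ?_)
    · rw [hq']
      refine (natDegree_sub_le _ _).trans (max_le ((natDegree_add_le _ _).trans (max_le ((natDegree_sub_le _ _).trans (max_le
        (natDegree_C_mul_X_pow_le _ _) ((natDegree_C_mul_X_pow_le _ _).trans (by omega))))
        ((natDegree_C_mul_X_pow_le _ _).trans (by omega)))) ((natDegree_C_mul_X_pow_le _ _).trans (by omega)))
    · rw [hqcoeff, if_pos rfl, if_neg (by omega), if_neg (by omega), if_neg (by omega)]
      simp only [sub_zero, add_zero]; exact hlc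
  have hq0 : q ≠ 0 := by
    intro h; have := hqcoeff (g + 3)
    rw [h, coeff_zero, if_pos rfl, if_neg (by omega), if_neg (by omega), if_neg (by omega)] at this
    simp only [sub_zero, add_zero] at this; exact hlc this.symm
  -- rescaled roots
  have hS : IsClosed {w : ℂ | w.im = 0 ∧ w.re ≤ 1} :=
    (isClosed_eq Complex.continuous_im continuous_const).inter (isClosed_le Complex.continuous_re continuous_const)
  have hroots : ∀ (n : ℕ) (z : ℂ), Polynomial.aeval z (Φ n) = 0 →
      (((((n : ℝ) + 1)⁻¹ : ℝ) : ℂ) * z) ∈ {w : ℂ | w.im = 0 ∧ w.re ≤ 1} := by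
    intro n z hz
    rw [hΦ] at hz; simp only [] at hz
    rw [aeval_pencil] at hz
    have hn : (0 : ℝ) < (n : ℝ) + 1 := by positivity
    obtain ⟨him, hre⟩ := hW ((n : ℝ) + 1) hn.le z hz
    refine ⟨by rw [Complex.mul_im, Complex.ofReal_re, Complex.ofReal_im, him]; ring, ?_⟩
    rw [Complex.mul_re, Complex.ofReal_re, Complex.ofReal_im, him, mul_zero, sub_zero]
    rw [inv_mul_le_iff₀ hn]; linarith
  -- coefficient convergence
  have hcoef : ∀ i : ℕ, Tendsto (fun n => (1 : ℝ) * ((Φ n).coeff i * (((n : ℝ) + 1)⁻¹) ^ (g + 3 - i))) atTop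
      (𝓝 (q.coeff i)) := by
    intro i
    have hform : ∀ n : ℕ, (1 : ℝ) * ((Φ n).coeff i * (((n : ℝ) + 1)⁻¹) ^ (g + 3 - i)) =
        F.coeff i * ((n : ℝ) + 1) ^ 0 * (((n : ℝ) + 1)⁻¹) ^ (g + 3 - i) +
        (X ^ 3 * G).coeff i * ((n : ℝ) + 1) ^ 0 * (((n : ℝ) + 1)⁻¹) ^ (g + 3 - i) -
        18 * (X ^ 2 * G).coeff i * ((n : ℝ) + 1) ^ 1 * (((n : ℝ) + 1)⁻¹) ^ (g + 3 - i) +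
        48 * (X * G).coeff i * ((n : ℝ) + 1) ^ 2 * (((n : ℝ) + 1)⁻¹) ^ (g + 3 - i) -
        32 * G.coeff i * ((n : ℝ) + 1) ^ 3 * (((n : ℝ) + 1)⁻¹) ^ (g + 3 - i) := by
      intro n; rw [hΦcoeff]; ring
    simp_rw [hform]
    have hA : Tendsto (fun n : ℕ => F.coeff i * ((n : ℝ) + 1) ^ 0 * (((n : ℝ) + 1)⁻¹) ^ (g + 3 - i)) atTop
        (𝓝 (if i = g + 3 then F.leadingCoeff else 0)) := by
      by_cases hi : i = g + 3
      · rw [if_pos hi, hi, hlcf, show g + 3 - (g + 3) = 0 by omega]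
        exact tendsto_const_nhds.congr fun n => (term_eq _ 0 n).symm
      · rw [if_neg hi]
        by_cases hFi : F.coeff i = 0
        · simp only [hFi, zero_mul]; exact tendsto_const_nhds
        · have := le_natDegree_of_ne_zero hFi
          exact term_tendsto_zero _ _ _ (by omega)
    have hB : Tendsto (fun n : ℕ => (X ^ 3 * G).coeff i * ((n : ℝ) + 1) ^ 0 * (((n : ℝ) + 1)⁻¹) ^ (g + 3 - i)) atTop
        (𝓝 (if i = g + 3 then G.leadingCoeff else 0)) := by
      rw [hXk 3]
      by_cases hi : i = g + 3
      · rw [if_pos hi, if_pos (by omega), show i - 3 = g by omega, hlcg, show g + 3 - i = 0 by omega]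
        exact tendsto_const_nhds.congr fun n => (term_eq _ 0 n).symm
      · rw [if_neg hi]
        split_ifs with h3
        · by_cases hGi : G.coeff (i - 3) = 0
          · simp only [hGi, zero_mul]; exact tendsto_const_nhds
          · have := le_natDegree_of_ne_zero hGi
            exact term_tendsto_zero _ _ _ (by omega)
        · simp only [zero_mul]; exact tendsto_const_nhds
    have hC : Tendsto (fun n : ℕ => 18 * (X ^ 2 * G).coeff i * ((n : ℝ) + 1) ^ 1 * (((n : ℝ) + 1)⁻¹) ^ (g + 3 - i)) atTop
        (𝓝 (if i = g + 2 then 18 * G.leadingCoeff else 0)) := by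
      rw [hXk 2]
      by_cases hi : i = g + 2
      · rw [if_pos hi, if_pos (by omega), show i - 2 = g by omega, hlcg, show g + 3 - i = 1 by omega]
        exact tendsto_const_nhds.congr fun n => (term_eq _ 1 n).symm
      · rw [if_neg hi]
        split_ifs with h2
        · by_cases hGi : G.coeff (i - 2) = 0
          · simp only [hGi, mul_zero, zero_mul]; exact tendsto_const_nhds
          · have := le_natDegree_of_ne_zero hGi
            exact term_tendsto_zero _ _ _ (by omega)
        · simp only [mul_zero, zero_mul]; exact tendsto_const_nhds
    have hD : Tendsto (fun n : ℕ => 48 * (X * G).coeff i * ((n : ℝ) + 1) ^ 2 * (((n : ℝ) + 1)⁻¹) ^ (g + 3 - i)) atTop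
        (𝓝 (if i = g + 1 then 48 * G.leadingCoeff else 0)) := by
      rw [hX1]
      by_cases hi : i = g + 1
      · rw [if_pos hi, if_pos (by omega), show i - 1 = g by omega, hlcg, show g + 3 - i = 2 by omega]
        exact tendsto_const_nhds.congr fun n => (term_eq _ 2 n).symm
      · rw [if_neg hi]
        split_ifs with h1
        · by_cases hGi : G.coeff (i - 1) = 0
          · simp only [hGi, mul_zero, zero_mul]; exact tendsto_const_nhds
          · have := le_natDegree_of_ne_zero hGi
            exact term_tendsto_zero _ _ _ (by omega)
        · simp only [mul_zero, zero_mul]; exact tendsto_const_nhds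
    have hE : Tendsto (fun n : ℕ => 32 * G.coeff i * ((n : ℝ) + 1) ^ 3 * (((n : ℝ) + 1)⁻¹) ^ (g + 3 - i)) atTop
        (𝓝 (if i = g then 32 * G.leadingCoeff else 0)) := by
      by_cases hi : i = g
      · rw [if_pos hi, hi, hlcg, show g + 3 - g = 3 by omega]
        exact tendsto_const_nhds.congr fun n => (term_eq _ 3 n).symm
      · rw [if_neg hi]
        by_cases hGi : G.coeff i = 0
        · simp only [hGi, mul_zero, zero_mul]; exact tendsto_const_nhds
        · have := le_natDegree_of_ne_zero hGi
          exact term_tendsto_zero _ _ _ (by omega)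
    have hsum := (((hA.add hB).sub hC).add hD).sub hE
    rw [hqcoeff]
    have hite : (if i = g + 3 then F.leadingCoeff else 0) + (if i = g + 3 then G.leadingCoeff else 0) =
        (if i = g + 3 then F.leadingCoeff + G.leadingCoeff else 0) := by
      split_ifs <;> ring
    rw [← hite]
    exact hsum
  exact rescaled_roots_mem Φ (g + 3) hdeg (fun n => ((n : ℝ) + 1)⁻¹) (fun _ => 1)
    (fun n => inv_ne_zero (by positivity)) (fun _ => one_ne_zero) _ hS hroots q hqdeg hq0 hcoef

end Summit.QuantumFields.YangMills.Cruxes.RationalToGeneral.HexagonNormalForm
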